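import Literature.NumberTheory.EllipticCurves.SupersingularDensitySerreMonomialProofs
import Literature.NumberTheory.GaloisRepresentations.SerreProp19GL2Fp
import HarnessLib

/-!
# Serre 1972, §4.2 c), Lemme 3 over `ℚ`: inert Frobenius in the normaliser case forces `a_p = 0`

Topic `NumberTheory/EllipticCurves`.  Theorems only (nothing is defined, no named fact): the
arithmetic half of step c) ("Élimination du cas ii) pour presque tout `l`") of the proof of
Serre's open image theorem — J.-P. Serre, *Propriétés galoisiennes des points d'ordre fini des
courbes elliptiques*, Invent. Math. 15 (1972), §4.2, Théorème 2, the tree's named fact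
`Literature.NumberTheory.EllipticCurves.serre_open_image` — for an elliptic curve over `ℚ` in
global minimal form:

> **Lemme 3.** *Si `v ∈ Σ` est inerte dans `K'`, et si `p_v ≠ 2, 3`, la courbe elliptique `Ẽ_v`
> est de hauteur 2.*  Proof (p. 296 of the original): for `l ∈ L''`, `l ≠ p_v`, `φ_l` is
> unramified at `v` and `Tr(F_v) ≡ Tr(π_w) (mod l)`; as `v` is inert in `K' = K'_l` one has
> `π_w ∈ N_l - C_l`, "mais les éléments de `N_l - C_l` ont une trace nulle", so
> `Tr(F_v) ≡ 0 (mod l)`; this holding for infinitely many `l`, `Tr(F_v) = 0`, hence height `2`.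

In the tree's language (`K = ℚ`): `ρ̄_{E,ℓ} = galoisRepTorsion W ℓ : Γ_ℚ → Aut(E[ℓ])`,
transported to `GL₂(𝔽_ℓ)` by any trace-compatible isomorphism `Φ` (such `Φ` exist,
`exists_mulEquiv_addAut_GL2`); Cartan subgroups `C ∈ Serre1972.cartanSubgroups (ZMod ℓ)` and
their normalisers (`SerreCartanSubgroupsGL2Fp`); "`v` inert in `K'_l`" is "`Φ (ρ̄_ℓ σ) ∈ N_l ∖ C_l`"
for an arithmetic Frobenius `σ` at a prime `𝔓 ∣ p`; `Tr(F_v) = a_p = W.frobeniusTrace p`; and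
"hauteur 2" (supersingular) is membership in `W.goodSupersingularPrimes` (`SupersingularDensity`,
`a_p = 0 ⇒ p ∣ a_p`).

* `WeierstrassCurve.natCast_dvd_frobeniusTrace_of_frobenius_not_mem_cartan` — one prime `ℓ ≠ p`:
  `Φ (ρ̄_ℓ σ) ∈ N ∖ C` forces `ℓ ∣ a_p` (trace zero on `N ∖ C`:
  `Serre1972.trace_eq_zero_of_mem_normalizer_of_not_mem`; `Tr ρ̄_ℓ(σ) = a_p mod ℓ`:
  `trace_galoisRepTorsion_frobenius_eq`).
* `Literature.NumberTheory.EllipticCurves.eq_zero_of_infinite_setOf_prime_dvd` — an integer with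
  infinitely many prime divisors is `0`.
* `WeierstrassCurve.frobeniusTrace_eq_zero_of_infinite_normalizer_not_mem_cartan` — **Lemme 3**:
  if this happens for infinitely many `ℓ` then `a_p = 0`;
  `WeierstrassCurve.mem_goodSupersingularPrimes_of_infinite_normalizer_not_mem_cartan` — hence
  `p` is a (good) supersingular prime.

## References

* [Serre1972] J.-P. Serre, Invent. Math. 15 (1972) 259–331, §4.2 c), Lemme 3 and its proof.
* [Serre1981] J.-P. Serre, Publ. Math. IHÉS 54 (1981), §8.1 (238) (`Tr ρ̄_ℓ(σ_p) ≡ a_p`).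
-/

noncomputable section

open scoped Classical NumberField
open IsDedekindDomain Field

namespace Literature.NumberTheory.EllipticCurves

/-- An integer divisible by infinitely many primes is `0` (the prime divisors of `a ≠ 0` are
`≤ |a|`). ("Comme cette congruence est réalisée pour une infinité de valeurs de `l`, on a
`Tr(F_v) = 0`".) [cite: Serre1972, §4.2, proof of Lemme 3] -/
theorem eq_zero_of_infinite_setOf_prime_dvd {a : ℤ}
    (h : {ℓ : ℕ | ℓ.Prime ∧ (ℓ : ℤ) ∣ a}.Infinite) : a = 0 := by
  by_contra ha
  apply h
  refine (Set.finite_Iic a.natAbs).subset ?_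
  rintro ℓ ⟨-, hdvd⟩
  exact Nat.le_of_dvd (Int.natAbs_pos.mpr ha) (Int.natCast_dvd.mp hdvd)

end Literature.NumberTheory.EllipticCurves

namespace WeierstrassCurve

open Literature.NumberTheory.EllipticCurves Literature.NumberTheory.GaloisRepresentations
  Literature.NumberTheory.GaloisRepresentations.Serre1972 NumberField Rat.HeightOneSpectrum

variable (W : WeierstrassCurve ℚ) [W.IsElliptic] [W.IsGloballyMinimal]

/-- **Serre 1972, §4.2, proof of Lemme 3, one prime `ℓ`.**  Let `E = W/ℚ` be in global minimal
form, `ℓ` a prime, `Φ : Aut(E[ℓ]) ≅ GL₂(𝔽_ℓ)` a trace-compatible isomorphism, `C` a Cartan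
subgroup of `GL₂(𝔽_ℓ)` (`ℓ ≠ 2` if `C` is split), `p ≠ ℓ` a prime of good reduction and `σ` an
arithmetic Frobenius at a prime `𝔓 ∣ p` of `\bar ℤ`.  If `Φ (ρ̄_{E,ℓ} σ)` lies in the
normaliser of `C` but not in `C` ("`π_w ∈ N_l - C_l`"), then `ℓ ∣ a_p`: the elements of `N - C`
have trace `0` and `Tr ρ̄_ℓ(σ) ≡ a_p (mod ℓ)`. [cite: Serre1972, §4.2, proof of Lemme 3] -/
theorem natCast_dvd_frobeniusTrace_of_frobenius_not_mem_cartan (ℓ : ℕ) [Fact ℓ.Prime]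
    (Φ : Multiplicative (AddAut (geomTorsion W ℓ)) ≃* GL (Fin 2) (ZMod ℓ))
    (hΦ : letI : Module (ZMod ℓ) (geomTorsion W ℓ) := AddSubgroup.torsionBy.zmodModule
      ∀ g : Multiplicative (AddAut (geomTorsion W ℓ)),
        Matrix.trace ((Φ g : GL (Fin 2) (ZMod ℓ)) : Matrix (Fin 2) (Fin 2) (ZMod ℓ)) =
          LinearMap.trace (ZMod ℓ) (geomTorsion W ℓ)
            ((Multiplicative.toAdd g).toAddMonoidHom.toZModLinearMap ℓ))
    {C : Subgroup (GL (Fin 2) (ZMod ℓ))} (hC : C ∈ cartanSubgroups (ZMod ℓ))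
    (hℓ2 : (∃ P : GL (Fin 2) (ZMod ℓ), C = splitCartan P) → ℓ ≠ 2)
    {p : ℕ} [Fact p.Prime] (hpℓ : p ≠ ℓ) (hgood : W.HasGoodReductionAtPrime p)
    {v : HeightOneSpectrum (𝓞 ℚ)} (hv : (primesEquiv v : ℕ) = p)
    {𝔓 : Ideal (absIntegers (𝓞 ℚ) ℚ)} (h𝔓 : 𝔓 ∈ v.primesAbove)
    {σ : absoluteGaloisGroup ℚ} (hσ : IsArithFrobAt (𝓞 ℚ) σ 𝔓)
    (hσN : Φ (galoisRepTorsion W ℓ σ) ∈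
      Subgroup.normalizer (C : Set (GL (Fin 2) (ZMod ℓ))))
    (hσC : Φ (galoisRepTorsion W ℓ σ) ∉ C) :
    (ℓ : ℤ) ∣ W.frobeniusTrace p := by
  letI : Module (ZMod ℓ) (geomTorsion W ℓ) := AddSubgroup.torsionBy.zmodModule
  have htr := trace_eq_zero_of_mem_normalizer_of_not_mem hC hℓ2 hσN hσC
  rw [hΦ, W.trace_galoisRepTorsion_frobenius_eq ℓ hpℓ hgood hv h𝔓 hσ] at htr
  exact (ZMod.intCast_zmod_eq_zero_iff_dvd _ _).mp htr

/-- **Serre 1972, §4.2, Lemme 3** ("si `v` est inerte dans `K'` … `Ẽ_v` est de hauteur 2"), over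
`ℚ`, trace form.  Let `p` be a prime of good reduction of `E = W/ℚ` (global minimal form) and
`σ` an arithmetic Frobenius at a prime `𝔓 ∣ p`.  Suppose that for infinitely many primes `ℓ`
("`l ∈ L''`") there are a trace-compatible `Φ_ℓ : Aut(E[ℓ]) ≅ GL₂(𝔽_ℓ)` and a Cartan subgroup
`C_ℓ` (`ℓ ≠ 2` if split) with `Φ_ℓ (ρ̄_{E,ℓ} σ) ∈ N(C_ℓ) ∖ C_ℓ` ("`v` inerte dans `K' = K'_l`").
Then `a_p = 0`: by the one-prime statement `ℓ ∣ a_p` for infinitely many `ℓ`.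
[cite: Serre1972, §4.2, Lemme 3] -/
theorem frobeniusTrace_eq_zero_of_infinite_normalizer_not_mem_cartan
    {p : ℕ} [Fact p.Prime] (hgood : W.HasGoodReductionAtPrime p)
    {v : HeightOneSpectrum (𝓞 ℚ)} (hv : (primesEquiv v : ℕ) = p)
    {𝔓 : Ideal (absIntegers (𝓞 ℚ) ℚ)} (h𝔓 : 𝔓 ∈ v.primesAbove)
    {σ : absoluteGaloisGroup ℚ} (hσ : IsArithFrobAt (𝓞 ℚ) σ 𝔓)
    (hL : {ℓ : ℕ | ∃ _ : Fact ℓ.Prime,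
      ∃ Φ : Multiplicative (AddAut (geomTorsion W ℓ)) ≃* GL (Fin 2) (ZMod ℓ),
        (letI : Module (ZMod ℓ) (geomTorsion W ℓ) := AddSubgroup.torsionBy.zmodModule
          ∀ g : Multiplicative (AddAut (geomTorsion W ℓ)),
            Matrix.trace ((Φ g : GL (Fin 2) (ZMod ℓ)) : Matrix (Fin 2) (Fin 2) (ZMod ℓ)) =
              LinearMap.trace (ZMod ℓ) (geomTorsion W ℓ)
                ((Multiplicative.toAdd g).toAddMonoidHom.toZModLinearMap ℓ)) ∧
        ∃ C ∈ cartanSubgroups (ZMod ℓ),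
          ((∃ P : GL (Fin 2) (ZMod ℓ), C = splitCartan P) → ℓ ≠ 2) ∧
          Φ (galoisRepTorsion W ℓ σ) ∈ Subgroup.normalizer (C : Set (GL (Fin 2) (ZMod ℓ))) ∧
          Φ (galoisRepTorsion W ℓ σ) ∉ C}.Infinite) :
    W.frobeniusTrace p = 0 := by
  apply eq_zero_of_infinite_setOf_prime_dvd
  refine Set.Infinite.mono ?_ (hL.sdiff (Set.finite_singleton p))
  rintro ℓ ⟨⟨hℓ, Φ, hΦ, C, hC, hℓ2, hN, hnC⟩, hℓp⟩
  haveI := hℓ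
  have hpℓ : p ≠ ℓ := fun h ↦ hℓp (Set.mem_singleton_iff.mpr h.symm)
  exact ⟨hℓ.out, W.natCast_dvd_frobeniusTrace_of_frobenius_not_mem_cartan ℓ Φ hΦ hC hℓ2 hpℓ
    hgood hv h𝔓 hσ hN hnC⟩

/-- **Serre 1972, §4.2, Lemme 3**, over `ℚ`: under the hypotheses of
`frobeniusTrace_eq_zero_of_infinite_normalizer_not_mem_cartan` the prime `p` is a good
supersingular prime of `W` ("`Ẽ_v` est de hauteur 2"; the tree's `goodSupersingularPrimes` asks
`p ∣ a_p`, which for `p ≥ 5` is `a_p = 0`, `mem_goodSupersingularPrimes_iff_of_five_le`).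
[cite: Serre1972, §4.2, Lemme 3] -/
theorem mem_goodSupersingularPrimes_of_infinite_normalizer_not_mem_cartan
    {p : ℕ} [Fact p.Prime] (hgood : W.HasGoodReductionAtPrime p)
    {v : HeightOneSpectrum (𝓞 ℚ)} (hv : (primesEquiv v : ℕ) = p)
    {𝔓 : Ideal (absIntegers (𝓞 ℚ) ℚ)} (h𝔓 : 𝔓 ∈ v.primesAbove)
    {σ : absoluteGaloisGroup ℚ} (hσ : IsArithFrobAt (𝓞 ℚ) σ 𝔓)
    (hL : {ℓ : ℕ | ∃ _ : Fact ℓ.Prime,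
      ∃ Φ : Multiplicative (AddAut (geomTorsion W ℓ)) ≃* GL (Fin 2) (ZMod ℓ),
        (letI : Module (ZMod ℓ) (geomTorsion W ℓ) := AddSubgroup.torsionBy.zmodModule
          ∀ g : Multiplicative (AddAut (geomTorsion W ℓ)),
            Matrix.trace ((Φ g : GL (Fin 2) (ZMod ℓ)) : Matrix (Fin 2) (Fin 2) (ZMod ℓ)) =
              LinearMap.trace (ZMod ℓ) (geomTorsion W ℓ)
                ((Multiplicative.toAdd g).toAddMonoidHom.toZModLinearMap ℓ)) ∧
        ∃ C ∈ cartanSubgroups (ZMod ℓ),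
          ((∃ P : GL (Fin 2) (ZMod ℓ), C = splitCartan P) → ℓ ≠ 2) ∧
          Φ (galoisRepTorsion W ℓ σ) ∈ Subgroup.normalizer (C : Set (GL (Fin 2) (ZMod ℓ))) ∧
          Φ (galoisRepTorsion W ℓ σ) ∉ C}.Infinite) :
    p ∈ W.goodSupersingularPrimes :=
  ⟨‹Fact p.Prime›, hgood, by
    rw [W.frobeniusTrace_eq_zero_of_infinite_normalizer_not_mem_cartan hgood hv h𝔓 hσ hL]
    exact dvd_zero _⟩

end WeierstrassCurve
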